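import Summits.ValiantsHypothesis.ValiantsHypothesis.Theorems.LacunarySymmetroidMatrixDescartesCensusChamber1472NegLeaf
import Summits.ValiantsHypothesis.ValiantsHypothesis.Theorems.LacunarySymmetroidMatrixDescartesCensusChamber1472PosLeaf
import Summits.ValiantsHypothesis.ValiantsHypothesis.Theorems.LacunarySymmetroidMatrixDescartesCensusChamberHalves

/-!
# `MatrixDescartes` census — chamber 1472: complete door-A row from TWO domination leaves (NFLOW v6)

HONEST FRAMING.  Object-search cell `pub-symmetroid`, door-A target `DoorA26 := PosRootLawAt 2 6 19`
(stmt-ValiantsHypothesis-19979; OPEN, typed, never asserted), crux `Theses.LacunarySymmetroid.MatrixDescartes`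
(stmt-ValiantsHypothesis-18050).  Chamber 1472 of theory g6's table (smallest member `(0,7,12,21,25,31)`, mirror 1498;
words `DIDDID` / `IDIIDI`) has BOTH orientations alive at sign level; each is killed for EVERY exponent vector of the chamber by
its own chamber-uniform single-monomial DOMINATION leaf (`no_twenty_on_chamber1472_neg` on `W(0,5|1,4)`, kit j279642; `no_twenty_on_chamber1472_pos` on
`G3(1,3,4)`, kit j279642), and `Census.posRootLawOn_of_chamber_halves` (tree file …CensusChamberHalves, g3; the case `det S_0 = 0` is Descartes) assembles the complete row
**`doorA26_on_chamber1472` — `PosRootLawOn 2 6 19 d` for EVERY `d` in the chamber**.  Nothing here bears on `V = 19`, on other chambers, on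
`DoorA26` as a whole (OPEN), on the crux, or on `VP ≠ VNP`.

[folklore] Kernel assembly of two exact certificates (generated by the seat's `gen7two.py`); elementary.
-/

-- `Summit.ValiantsHypothesis.ValiantsHypothesis.…` repeats a component by the D-0017 layout
-- (single-conjunct summit), which the `dupNamespace` linter flags; the name is mandated.
set_option linter.dupNamespace false

namespace Summit.ValiantsHypothesis.ValiantsHypothesis.Theorems.LacunarySymmetroidMatrixDescartes.Census

open Polynomial Finset
open scoped BigOperators Polynomial Matrix

/-- **DOOR-A ROW ON THE WHOLE CHAMBER 1472**: every exponent vector whose pair sums are ordered as in chamber 1472 (smallest member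
`(0,7,12,21,25,31)`) satisfies `ζ(2,6; d) ≤ 19` — orientation `s = −` and `s = +` each by a domination leaf. [folklore] -/
theorem doorA26_on_chamber1472 (d : Fin 6 → ℕ)
    (hd : StrictMono ((fun p : Fin 6 × Fin 6 => d p.1 + d p.2) ∘
      ![(0, 0), (0, 1), (0, 2), (1, 1), (1, 2), (0, 3), (2, 2), (0, 4), (1, 3), (0, 5), (1, 4),
        (2, 3), (2, 4), (1, 5), (3, 3), (2, 5), (3, 4), (4, 4), (3, 5), (4, 5), (5, 5)])) :
    PosRootLawOn 2 6 19 d :=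
  posRootLawOn_of_chamber_halves _ 0 (by decide) (by decide) d hd
    (fun S hS hZ hs => no_twenty_on_chamber1472_pos d hd S hS hZ hs)
    (fun S hS hZ hs => no_twenty_on_chamber1472_neg d hd S hS hZ hs)

/-- Non-vacuity: the smallest member of chamber 1472. [folklore] -/
example : PosRootLawOn 2 6 19 (![0, 7, 12, 21, 25, 31] : Fin 6 → ℕ) :=
  doorA26_on_chamber1472 _ (Fin.strictMono_iff_lt_succ.2 (by decide))

end Summit.ValiantsHypothesis.ValiantsHypothesis.Theorems.LacunarySymmetroidMatrixDescartes.Census
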